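import Mathlib
import HarnessLib
import Summits.HubbardSuperconductivity.HubbardSuperconductivity.Theorems.KLProgrammeKLRegimeSplitSlotsV17F2
import Summits.HubbardSuperconductivity.HubbardSuperconductivity.Theorems.KLProgrammeKLRegimeEngineTwoLegStepHistDoors

/-!
# K3 gen 7-flow, ENGINE child `KLRegimeEngineV17F` (stmt-HubbardSuperconductivity-20368) on the REV-2 bundle `klPredsV17F2` (S1 rev 2 = cure 1, p2's
# `…SplitSlotsV17F2`, p527694): the two-leg doors of stubs (e)/(M) for the slot `TwoLegStepV17F2` (history `histV17F2`: cured engine slot inside)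

Cell gate-hubbard-kl, seat hubbard-kl-r2d-p1 (g5).  One-line instances of the history-generic doors of `…EngineTwoLegStepHistDoors` at
`hist := histV17F2 ∧ TwoLegSlopes` — the named twins of `…EngineTwoLegStepV17FDoor{,Pkg,Legs}` (p526027/p526589/p527732) for the rev-2 text:

* `twoLegStepV17F2_of_conjuncts` / `TwoLegStepV17F2.conjuncts` / `twoLegStepV17F2_of_jets_slopes_nestedLegs`;
* `twoLegStepV17F2_of_jets_sepTubeGradient_nestedLegs` (curve thresholds) / `…_pkg` (`R.WF2`, `klEngC₃3`, `klEngU₀4`) / `twoLegStepV17F2_zero_…` ((M), `K₀ = 0`);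
* `cutLeg_allScales_of_step_V17F2` / `spLeg_allScales_of_step_V17F2` — rows C1/C2 at all scales from the one-step comparison (quarter budget).

(e)-F2 CLOSER SHAPE (template twin B re-keyed per p2 KL STATUS 11:30:18Z): `stub_twoLeg_step … hfr hE hJ :=
twoLegStepV17F2_of_jets_sepTubeGradient_nestedLegs_pkg klEngGeo6 (klEngQ6 P R) P hR hc hc3 hμ hU (hUle.trans «klEngU₀6 ≤ klEngU₀4») hβ hβc hL hn hfr hCL hpk hpk' hJ.1 hJ.2
hz hm₁' hfit1 hcut hsp` — open inputs rows B1–B3 (engine), C1–C2 (VL; or their one-step forms via `cutLeg_/spLeg_allScales_of_step_V17F2`), A1 = stub 6-F.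
Proofs only; no definitions; nothing about the model is asserted; nothing asserts superconductivity.  [cite: BenfattoGiulianiMastropietro2006] (§2.4 (2.23)).
-/

noncomputable section

namespace Summit.HubbardSuperconductivity.HubbardSuperconductivity.Theorems.EngineV8

set_option linter.dupNamespace false -- summit = problem name (single-conjunct summit), D-0017

open Real Finset Literature.MathematicalPhysics.QuantumLattice Literature.Probability.LatticeModels
open Literature.MathematicalPhysics.QuantumLattice.FermiRG Literature.MathematicalPhysics.QuantumLattice.BandSectorCounting
open Summit.HubbardSuperconductivity.HubbardSuperconductivity.Theorems.KLProgrammeLegKernels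
open Summit.HubbardSuperconductivity.HubbardSuperconductivity.Theorems.DispersionFlow
open Summit.HubbardSuperconductivity.HubbardSuperconductivity.Theorems.PerturbedFermiCurve
open Summit.HubbardSuperconductivity.HubbardSuperconductivity.Theorems.KLRegimeSplit
open Summit.HubbardSuperconductivity.HubbardSuperconductivity.Theorems.TwoPointAssembly

section V17F2

variable {L M : ℕ} [NeZero L] [NeZero M] {G : GeoConsts} {P : SplitConsts} {Q : EngConsts} {R : RenConsts} {β U μ : ℝ} {n : ℕ}

/-- The rev-2 comparison history (with slopes) yields the `C⁴` reading at its scale (the `hC` input of the history-generic legs). -/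
theorem histV17F2_slopes_contDiff (L' M' : ℕ) [NeZero L'] [NeZero M'] (j : ℕ)
    (h : histV17F2 L' M' G P Q R β U μ j ∧ TwoLegSlopes L' M' R β U μ (klFlowFrameU L' M' β U μ j) j) :
    ContDiff ℝ 4 (fun θ : ℝ => klLocalPart L' M' β U μ (klFlowFrameU L' M' β U μ j) j θ) :=
  h.1.2.2.2.1

/-- **`TwoLegStepV17F2` from its three conjuncts** (order of the slot text). -/
theorem twoLegStepV17F2_of_conjuncts (h1 : TwoLegReadJetsF L M G Q β U μ n) (h2 : TwoLegSlopes L M R β U μ (klFlowFrameU L M β U μ n) n)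
    (h3 : TwoLegVolumeRateF L M
      (fun L'' M'' _ _ j => histV17F2 L'' M'' G P Q R β U μ j ∧ TwoLegSlopes L'' M'' R β U μ (klFlowFrameU L'' M'' β U μ j) j) Q β U μ n) :
    TwoLegStepV17F2 L M G P Q R β U μ n :=
  ⟨h1, h2, h3⟩

/-- **The three conjuncts of `TwoLegStepV17F2`** (converse bookkeeping). -/
theorem TwoLegStepV17F2.conjuncts (h : TwoLegStepV17F2 L M G P Q R β U μ n) :
    TwoLegReadJetsF L M G Q β U μ n ∧ TwoLegSlopes L M R β U μ (klFlowFrameU L M β U μ n) n ∧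
      TwoLegVolumeRateF L M
        (fun L'' M'' _ _ j => histV17F2 L'' M'' G P Q R β U μ j ∧ TwoLegSlopes L'' M'' R β U μ (klFlowFrameU L'' M'' β U μ j) j) Q β U μ n :=
  h

/-- **The rev-2 slot from (A) reading jets, (B) slopes at `K_n`, (C) two nested legs** (quarter budget). -/
theorem twoLegStepV17F2_of_jets_slopes_nestedLegs (h1 : TwoLegReadJetsF L M G Q β U μ n)
    (h2 : TwoLegSlopes L M R β U μ (klFlowFrameU L M β U μ n) n) (hCL : 0 ≤ Q.CL β n)
    (hcut : ∀ (Mq : ℕ → ℕ) (L₁ M₁ M₂ : ℕ) [NeZero L₁] [NeZero M₁] [NeZero M₂], L ≤ L₁ → Q.M0 β L₁ ≤ M₁ → Mq L₁ ≤ M₁ → M₁ ≤ M₂ →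
      (∀ j < n, histV17F2 L₁ M₁ G P Q R β U μ j ∧ TwoLegSlopes L₁ M₁ R β U μ (klFlowFrameU L₁ M₁ β U μ j) j) →
      (∀ j < n, histV17F2 L₁ M₂ G P Q R β U μ j ∧ TwoLegSlopes L₁ M₂ R β U μ (klFlowFrameU L₁ M₂ β U μ j) j) →
        ∀ θ : ℝ, |klLocalPart L₁ M₁ β U μ (klFlowFrameU L₁ M₁ β U μ n) n θ -
          klLocalPart L₁ M₂ β U μ (klFlowFrameU L₁ M₂ β U μ n) n θ| ≤ Q.CL β n / 4 / L₁)
    (hsp : ∀ (Mq : ℕ → ℕ) (L₁ L₂ M₂ : ℕ) [NeZero L₁] [NeZero L₂] [NeZero M₂], L ≤ L₁ → L₁ ∣ L₂ → Q.M0 β L₁ ≤ M₂ → Mq L₁ ≤ M₂ →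
      Q.M0 β L₂ ≤ M₂ → Mq L₂ ≤ M₂ →
      (∀ j < n, histV17F2 L₁ M₂ G P Q R β U μ j ∧ TwoLegSlopes L₁ M₂ R β U μ (klFlowFrameU L₁ M₂ β U μ j) j) →
      (∀ j < n, histV17F2 L₂ M₂ G P Q R β U μ j ∧ TwoLegSlopes L₂ M₂ R β U μ (klFlowFrameU L₂ M₂ β U μ j) j) →
        ∀ θ : ℝ, |klLocalPart L₁ M₂ β U μ (klFlowFrameU L₁ M₂ β U μ n) n θ -
          klLocalPart L₂ M₂ β U μ (klFlowFrameU L₂ M₂ β U μ n) n θ| ≤ Q.CL β n / 4 / L₁) :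
    TwoLegStepV17F2 L M G P Q R β U μ n :=
  twoLegSlot_of_jets_slopes_nestedLegs
    (hist := fun L'' M'' _ _ j => histV17F2 L'' M'' G P Q R β U μ j ∧ TwoLegSlopes L'' M'' R β U μ (klFlowFrameU L'' M'' β U μ j) j)
    h1 h2 hCL hcut hsp

/-- **THE REV-2 TWO-LEG DOOR, curve-threshold currency** (as `twoLegStepV17F_of_jets_sepTubeGradient_nestedLegs`, history `histV17F2`). -/
theorem twoLegStepV17F2_of_jets_sepTubeGradient_nestedLegs (G : GeoConsts) (Q : EngConsts) {P : SplitConsts} {R : RenConsts}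
    (hR : ∀ j, 0 ≤ R.Gfr j) {c : ℝ} (hc : 0 < c) (hcle : c ≤ klCurveC3 R) {μ : ℝ} (hμ : μ ∈ klWindowC) {U : ℝ} (hU : 0 < U)
    (hUle : U ≤ klCurveU0 R) {β : ℝ} (hβ : klBetaMin ≤ β) (hβc : β ≤ Real.exp (c / U ^ 2)) {L M : ℕ} [NeZero L] [NeZero M]
    (hL : klEngL₃ β U ≤ L) {n : ℕ} (hn : n ≤ nScales β + 1) (hK : FrameOK R U (nScales β) μ (klFlowFrameU L M β U μ n))
    (hCL : 0 ≤ Q.CL β n)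
    {cN cN' : ℕ → ℝ} (hpk : ∀ k, cN k ≤ G.S k) (hpk' : ∀ k, cN' k ≤ Q.S' k)
    (hC : ContDiff ℝ 4 (fun θ : ℝ => klLocalPart L M β U μ (klFlowFrameU L M β U μ n) n θ))
    (hjets : ∀ k ≤ 4, ∀ θ : ℝ,
      |iteratedDeriv k (fun θ : ℝ => klLocalPart L M β U μ (klFlowFrameU L M β U μ n) n θ) θ| ≤ curveJetBar cN cN' U k n)
    (hz : ∀ k ∈ klShell L μ (klFlowFrameU L M β U μ n) n, |klFieldStrength L M β U μ (klFlowFrameU L M β U μ n) n k - 1| ≤ R.cz * |U|)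
    {m₁' : ℝ}
    (hm₁' : ∀ q : Momentum, |frameLevel μ (klFlowFrameU L M β U μ n) q| ≤ klScale klE0 n →
      ‖fderiv ℝ (evalM (symInterp L (fun p => klLocSelfEnergyRe L M β U μ (klFlowFrameU L M β U μ n) n p -
        (klFlowFrameU L M β U μ n).eval (latticeMomentum L p)))) q‖ ≤ m₁')
    (hfit1 : m₁' + 4 / 3 * R.Gfr 1 * U ^ 2 ≤ R.cz * |U| * (cDtmin (-1.2) (-0.05) / 2))
    (hcut : ∀ (Mq : ℕ → ℕ) (L₁ M₁ M₂ : ℕ) [NeZero L₁] [NeZero M₁] [NeZero M₂], L ≤ L₁ → Q.M0 β L₁ ≤ M₁ → Mq L₁ ≤ M₁ → M₁ ≤ M₂ →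
      (∀ j < n, histV17F2 L₁ M₁ G P Q R β U μ j ∧ TwoLegSlopes L₁ M₁ R β U μ (klFlowFrameU L₁ M₁ β U μ j) j) →
      (∀ j < n, histV17F2 L₁ M₂ G P Q R β U μ j ∧ TwoLegSlopes L₁ M₂ R β U μ (klFlowFrameU L₁ M₂ β U μ j) j) →
        ∀ θ : ℝ, |klLocalPart L₁ M₁ β U μ (klFlowFrameU L₁ M₁ β U μ n) n θ -
          klLocalPart L₁ M₂ β U μ (klFlowFrameU L₁ M₂ β U μ n) n θ| ≤ Q.CL β n / 4 / L₁)
    (hsp : ∀ (Mq : ℕ → ℕ) (L₁ L₂ M₂ : ℕ) [NeZero L₁] [NeZero L₂] [NeZero M₂], L ≤ L₁ → L₁ ∣ L₂ → Q.M0 β L₁ ≤ M₂ → Mq L₁ ≤ M₂ →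
      Q.M0 β L₂ ≤ M₂ → Mq L₂ ≤ M₂ →
      (∀ j < n, histV17F2 L₁ M₂ G P Q R β U μ j ∧ TwoLegSlopes L₁ M₂ R β U μ (klFlowFrameU L₁ M₂ β U μ j) j) →
      (∀ j < n, histV17F2 L₂ M₂ G P Q R β U μ j ∧ TwoLegSlopes L₂ M₂ R β U μ (klFlowFrameU L₂ M₂ β U μ j) j) →
        ∀ θ : ℝ, |klLocalPart L₁ M₂ β U μ (klFlowFrameU L₁ M₂ β U μ n) n θ -
          klLocalPart L₂ M₂ β U μ (klFlowFrameU L₂ M₂ β U μ n) n θ| ≤ Q.CL β n / 4 / L₁) :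
    TwoLegStepV17F2 L M G P Q R β U μ n :=
  twoLegSlot_of_jets_sepTubeGradient_nestedLegs
    (hist := fun L'' M'' _ _ j => histV17F2 L'' M'' G P Q R β U μ j ∧ TwoLegSlopes L'' M'' R β U μ (klFlowFrameU L'' M'' β U μ j) j)
    G Q hR hc hcle hμ hU hUle hβ hβc hL hn hK hCL hpk hpk' hC hjets hz hm₁' hfit1 hcut hsp

/-- **THE REV-2 TWO-LEG DOOR, engine-threshold currency** (`R.WF2`, `c ≤ klEngC₃3 P R`, `U ≤ klEngU₀4 P R c`; (e)-F2 closer shape: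
`twoLegStepV17F2_of_jets_sepTubeGradient_nestedLegs_pkg … hJ.1 hJ.2 hz hm₁' hfit1 hcut hsp` with `hJ : TwoLegReadJetBound L M cN cN' β U μ (K_n) n`). -/
theorem twoLegStepV17F2_of_jets_sepTubeGradient_nestedLegs_pkg (G : GeoConsts) (Q : EngConsts) (P : SplitConsts) {R : RenConsts} (hR : R.WF2)
    {c : ℝ} (hc : 0 < c) (hc3 : c ≤ klEngC₃3 P R) {μ : ℝ} (hμ : μ ∈ klWindowC) {U : ℝ} (hU : 0 < U) (hUle : U ≤ klEngU₀4 P R c)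
    {β : ℝ} (hβ : klBetaMin ≤ β) (hβc : β ≤ Real.exp (c / U ^ 2)) {L M : ℕ} [NeZero L] [NeZero M] (hL : klEngL₃ β U ≤ L) {n : ℕ}
    (hn : n ≤ nScales β + 1) (hK : FrameOK R U (nScales β) μ (klFlowFrameU L M β U μ n)) (hCL : 0 ≤ Q.CL β n)
    {cN cN' : ℕ → ℝ} (hpk : ∀ k, cN k ≤ G.S k) (hpk' : ∀ k, cN' k ≤ Q.S' k)
    (hC : ContDiff ℝ 4 (fun θ : ℝ => klLocalPart L M β U μ (klFlowFrameU L M β U μ n) n θ))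
    (hjets : ∀ k ≤ 4, ∀ θ : ℝ,
      |iteratedDeriv k (fun θ : ℝ => klLocalPart L M β U μ (klFlowFrameU L M β U μ n) n θ) θ| ≤ curveJetBar cN cN' U k n)
    (hz : ∀ k ∈ klShell L μ (klFlowFrameU L M β U μ n) n, |klFieldStrength L M β U μ (klFlowFrameU L M β U μ n) n k - 1| ≤ R.cz * |U|)
    {m₁' : ℝ}
    (hm₁' : ∀ q : Momentum, |frameLevel μ (klFlowFrameU L M β U μ n) q| ≤ klScale klE0 n →
      ‖fderiv ℝ (evalM (symInterp L (fun p => klLocSelfEnergyRe L M β U μ (klFlowFrameU L M β U μ n) n p -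
        (klFlowFrameU L M β U μ n).eval (latticeMomentum L p)))) q‖ ≤ m₁')
    (hfit1 : m₁' + 4 / 3 * R.Gfr 1 * U ^ 2 ≤ R.cz * |U| * (cDtmin (-1.2) (-0.05) / 2))
    (hcut : ∀ (Mq : ℕ → ℕ) (L₁ M₁ M₂ : ℕ) [NeZero L₁] [NeZero M₁] [NeZero M₂], L ≤ L₁ → Q.M0 β L₁ ≤ M₁ → Mq L₁ ≤ M₁ → M₁ ≤ M₂ →
      (∀ j < n, histV17F2 L₁ M₁ G P Q R β U μ j ∧ TwoLegSlopes L₁ M₁ R β U μ (klFlowFrameU L₁ M₁ β U μ j) j) →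
      (∀ j < n, histV17F2 L₁ M₂ G P Q R β U μ j ∧ TwoLegSlopes L₁ M₂ R β U μ (klFlowFrameU L₁ M₂ β U μ j) j) →
        ∀ θ : ℝ, |klLocalPart L₁ M₁ β U μ (klFlowFrameU L₁ M₁ β U μ n) n θ -
          klLocalPart L₁ M₂ β U μ (klFlowFrameU L₁ M₂ β U μ n) n θ| ≤ Q.CL β n / 4 / L₁)
    (hsp : ∀ (Mq : ℕ → ℕ) (L₁ L₂ M₂ : ℕ) [NeZero L₁] [NeZero L₂] [NeZero M₂], L ≤ L₁ → L₁ ∣ L₂ → Q.M0 β L₁ ≤ M₂ → Mq L₁ ≤ M₂ →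
      Q.M0 β L₂ ≤ M₂ → Mq L₂ ≤ M₂ →
      (∀ j < n, histV17F2 L₁ M₂ G P Q R β U μ j ∧ TwoLegSlopes L₁ M₂ R β U μ (klFlowFrameU L₁ M₂ β U μ j) j) →
      (∀ j < n, histV17F2 L₂ M₂ G P Q R β U μ j ∧ TwoLegSlopes L₂ M₂ R β U μ (klFlowFrameU L₂ M₂ β U μ j) j) →
        ∀ θ : ℝ, |klLocalPart L₁ M₂ β U μ (klFlowFrameU L₁ M₂ β U μ n) n θ -
          klLocalPart L₂ M₂ β U μ (klFlowFrameU L₂ M₂ β U μ n) n θ| ≤ Q.CL β n / 4 / L₁) :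
    TwoLegStepV17F2 L M G P Q R β U μ n :=
  twoLegSlot_of_jets_sepTubeGradient_nestedLegs_pkg
    (hist := fun L'' M'' _ _ j => histV17F2 L'' M'' G P Q R β U μ j ∧ TwoLegSlopes L'' M'' R β U μ (klFlowFrameU L'' M'' β U μ j) j)
    G Q P hR hc hc3 hμ hU hUle hβ hβc hL hn hK hCL hpk hpk' hC hjets hz hm₁' hfit1 hcut hsp

/-- **THE REV-2 TWO-LEG DOOR AT SCALE `0`** ((M) shape, `K₀ = 0` literal; vacuous histories kept for shape). -/
theorem twoLegStepV17F2_zero_of_jets_sepTubeGradient_nestedLegs (G : GeoConsts) (Q : EngConsts) {P : SplitConsts} {R : RenConsts}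
    (hR : ∀ j, 0 ≤ R.Gfr j) {c : ℝ} (hc : 0 < c) (hcle : c ≤ klCurveC3 R) {μ : ℝ} (hμ : μ ∈ klWindowC) {U : ℝ} (hU : 0 < U)
    (hUle : U ≤ klCurveU0 R) {β : ℝ} (hβ : klBetaMin ≤ β) (hβc : β ≤ Real.exp (c / U ^ 2)) {L M : ℕ} [NeZero L] [NeZero M]
    (hL : klEngL₃ β U ≤ L) (hK : FrameOK R U (nScales β) μ 0) (hCL : 0 ≤ Q.CL β 0)
    {cN cN' : ℕ → ℝ} (hpk : ∀ k, cN k ≤ G.S k) (hpk' : ∀ k, cN' k ≤ Q.S' k)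
    (hC : ContDiff ℝ 4 (fun θ : ℝ => klLocalPart L M β U μ 0 0 θ))
    (hjets : ∀ k ≤ 4, ∀ θ : ℝ, |iteratedDeriv k (fun θ : ℝ => klLocalPart L M β U μ 0 0 θ) θ| ≤ curveJetBar cN cN' U k 0)
    (hz : ∀ k ∈ klShell L μ 0 0, |klFieldStrength L M β U μ 0 0 k - 1| ≤ R.cz * |U|)
    {m₁' : ℝ}
    (hm₁' : ∀ q : Momentum, |frameLevel μ 0 q| ≤ klScale klE0 0 →
      ‖fderiv ℝ (evalM (symInterp L (fun p => klLocSelfEnergyRe L M β U μ 0 0 p - (0 : TrigPolyC4v).eval (latticeMomentum L p)))) q‖ ≤ m₁')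
    (hfit1 : m₁' + 4 / 3 * R.Gfr 1 * U ^ 2 ≤ R.cz * |U| * (cDtmin (-1.2) (-0.05) / 2))
    (hcut : ∀ (Mq : ℕ → ℕ) (L₁ M₁ M₂ : ℕ) [NeZero L₁] [NeZero M₁] [NeZero M₂], L ≤ L₁ → Q.M0 β L₁ ≤ M₁ → Mq L₁ ≤ M₁ → M₁ ≤ M₂ →
      (∀ j < 0, histV17F2 L₁ M₁ G P Q R β U μ j ∧ TwoLegSlopes L₁ M₁ R β U μ (klFlowFrameU L₁ M₁ β U μ j) j) →
      (∀ j < 0, histV17F2 L₁ M₂ G P Q R β U μ j ∧ TwoLegSlopes L₁ M₂ R β U μ (klFlowFrameU L₁ M₂ β U μ j) j) →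
        ∀ θ : ℝ, |klLocalPart L₁ M₁ β U μ 0 0 θ - klLocalPart L₁ M₂ β U μ 0 0 θ| ≤ Q.CL β 0 / 4 / L₁)
    (hsp : ∀ (Mq : ℕ → ℕ) (L₁ L₂ M₂ : ℕ) [NeZero L₁] [NeZero L₂] [NeZero M₂], L ≤ L₁ → L₁ ∣ L₂ → Q.M0 β L₁ ≤ M₂ → Mq L₁ ≤ M₂ →
      Q.M0 β L₂ ≤ M₂ → Mq L₂ ≤ M₂ →
      (∀ j < 0, histV17F2 L₁ M₂ G P Q R β U μ j ∧ TwoLegSlopes L₁ M₂ R β U μ (klFlowFrameU L₁ M₂ β U μ j) j) →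
      (∀ j < 0, histV17F2 L₂ M₂ G P Q R β U μ j ∧ TwoLegSlopes L₂ M₂ R β U μ (klFlowFrameU L₂ M₂ β U μ j) j) →
        ∀ θ : ℝ, |klLocalPart L₁ M₂ β U μ 0 0 θ - klLocalPart L₂ M₂ β U μ 0 0 θ| ≤ Q.CL β 0 / 4 / L₁) :
    TwoLegStepV17F2 L M G P Q R β U μ 0 :=
  twoLegStepV17F2_of_jets_sepTubeGradient_nestedLegs G Q hR hc hcle hμ hU hUle hβ hβc hL (Nat.zero_le _) hK hCL hpk hpk' hC hjets hz
    hm₁' hfit1 hcut hsp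

/-- **Rev-2 CUTOFF LEG at all scales `≤ N` from the one-step comparison** (quarter budget; conclusion = the rev-2 door's `hcut`). -/
theorem cutLeg_allScales_of_step_V17F2 {L : ℕ} (hμ : μ ∈ klWindowC) {N : ℕ}
    (hstep : ∀ n ≤ N, ∀ (Mq : ℕ → ℕ) (L₁ M₁ M₂ : ℕ) [NeZero L₁] [NeZero M₁] [NeZero M₂], L ≤ L₁ → Q.M0 β L₁ ≤ M₁ → Mq L₁ ≤ M₁ → M₁ ≤ M₂ →
      (∀ j < n, histV17F2 L₁ M₁ G P Q R β U μ j ∧ TwoLegSlopes L₁ M₁ R β U μ (klFlowFrameU L₁ M₁ β U μ j) j) →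
      (∀ j < n, histV17F2 L₁ M₂ G P Q R β U μ j ∧ TwoLegSlopes L₁ M₂ R β U μ (klFlowFrameU L₁ M₂ β U μ j) j) →
      (∀ m < n, ∀ θ : ℝ, |klLocalPart L₁ M₁ β U μ (klFlowFrameU L₁ M₁ β U μ m) m θ -
        klLocalPart L₁ M₂ β U μ (klFlowFrameU L₁ M₂ β U μ m) m θ| ≤ Q.CL β m / 4 / L₁) →
      (∀ q : Fin 2 → ℝ, |(klFlowFrameU L₁ M₁ β U μ n).eval q - (klFlowFrameU L₁ M₂ β U μ n).eval q| ≤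
        (∑ m ∈ range n, Q.CL β m / 4) / L₁) →
        ∀ θ : ℝ, |klLocalPart L₁ M₁ β U μ (klFlowFrameU L₁ M₁ β U μ n) n θ -
          klLocalPart L₁ M₂ β U μ (klFlowFrameU L₁ M₂ β U μ n) n θ| ≤ Q.CL β n / 4 / L₁)
    {n : ℕ} (hn : n ≤ N) :
    ∀ (Mq : ℕ → ℕ) (L₁ M₁ M₂ : ℕ) [NeZero L₁] [NeZero M₁] [NeZero M₂], L ≤ L₁ → Q.M0 β L₁ ≤ M₁ → Mq L₁ ≤ M₁ → M₁ ≤ M₂ →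
      (∀ j < n, histV17F2 L₁ M₁ G P Q R β U μ j ∧ TwoLegSlopes L₁ M₁ R β U μ (klFlowFrameU L₁ M₁ β U μ j) j) →
      (∀ j < n, histV17F2 L₁ M₂ G P Q R β U μ j ∧ TwoLegSlopes L₁ M₂ R β U μ (klFlowFrameU L₁ M₂ β U μ j) j) →
        ∀ θ : ℝ, |klLocalPart L₁ M₁ β U μ (klFlowFrameU L₁ M₁ β U μ n) n θ -
          klLocalPart L₁ M₂ β U μ (klFlowFrameU L₁ M₂ β U μ n) n θ| ≤ Q.CL β n / 4 / L₁ :=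
  cutLeg_allScales_of_step_hist (a := fun n => Q.CL β n / 4)
    (hist := fun L'' M'' _ _ j => histV17F2 L'' M'' G P Q R β U μ j ∧ TwoLegSlopes L'' M'' R β U μ (klFlowFrameU L'' M'' β U μ j) j)
    hμ (fun L' M' _ _ j h => histV17F2_slopes_contDiff L' M' j h) hstep n hn

/-- **Rev-2 SPATIAL NESTED LEG at all scales `≤ N` from the one-step comparison** (quarter budget; conclusion = the rev-2 door's `hsp`). -/
theorem spLeg_allScales_of_step_V17F2 {L : ℕ} (hμ : μ ∈ klWindowC) {N : ℕ}
    (hstep : ∀ n ≤ N, ∀ (Mq : ℕ → ℕ) (L₁ L₂ M₂ : ℕ) [NeZero L₁] [NeZero L₂] [NeZero M₂], L ≤ L₁ → L₁ ∣ L₂ → Q.M0 β L₁ ≤ M₂ → Mq L₁ ≤ M₂ →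
      Q.M0 β L₂ ≤ M₂ → Mq L₂ ≤ M₂ →
      (∀ j < n, histV17F2 L₁ M₂ G P Q R β U μ j ∧ TwoLegSlopes L₁ M₂ R β U μ (klFlowFrameU L₁ M₂ β U μ j) j) →
      (∀ j < n, histV17F2 L₂ M₂ G P Q R β U μ j ∧ TwoLegSlopes L₂ M₂ R β U μ (klFlowFrameU L₂ M₂ β U μ j) j) →
      (∀ m < n, ∀ θ : ℝ, |klLocalPart L₁ M₂ β U μ (klFlowFrameU L₁ M₂ β U μ m) m θ -
        klLocalPart L₂ M₂ β U μ (klFlowFrameU L₂ M₂ β U μ m) m θ| ≤ Q.CL β m / 4 / L₁) →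
      (∀ q : Fin 2 → ℝ, |(klFlowFrameU L₁ M₂ β U μ n).eval q - (klFlowFrameU L₂ M₂ β U μ n).eval q| ≤
        (∑ m ∈ range n, Q.CL β m / 4) / L₁) →
        ∀ θ : ℝ, |klLocalPart L₁ M₂ β U μ (klFlowFrameU L₁ M₂ β U μ n) n θ -
          klLocalPart L₂ M₂ β U μ (klFlowFrameU L₂ M₂ β U μ n) n θ| ≤ Q.CL β n / 4 / L₁)
    {n : ℕ} (hn : n ≤ N) :
    ∀ (Mq : ℕ → ℕ) (L₁ L₂ M₂ : ℕ) [NeZero L₁] [NeZero L₂] [NeZero M₂], L ≤ L₁ → L₁ ∣ L₂ → Q.M0 β L₁ ≤ M₂ → Mq L₁ ≤ M₂ →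
      Q.M0 β L₂ ≤ M₂ → Mq L₂ ≤ M₂ →
      (∀ j < n, histV17F2 L₁ M₂ G P Q R β U μ j ∧ TwoLegSlopes L₁ M₂ R β U μ (klFlowFrameU L₁ M₂ β U μ j) j) →
      (∀ j < n, histV17F2 L₂ M₂ G P Q R β U μ j ∧ TwoLegSlopes L₂ M₂ R β U μ (klFlowFrameU L₂ M₂ β U μ j) j) →
        ∀ θ : ℝ, |klLocalPart L₁ M₂ β U μ (klFlowFrameU L₁ M₂ β U μ n) n θ -
          klLocalPart L₂ M₂ β U μ (klFlowFrameU L₂ M₂ β U μ n) n θ| ≤ Q.CL β n / 4 / L₁ :=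
  spLeg_allScales_of_step_hist (a := fun n => Q.CL β n / 4)
    (hist := fun L'' M'' _ _ j => histV17F2 L'' M'' G P Q R β U μ j ∧ TwoLegSlopes L'' M'' R β U μ (klFlowFrameU L'' M'' β U μ j) j)
    hμ (fun L' M' _ _ j h => histV17F2_slopes_contDiff L' M' j h) hstep n hn

end V17F2

end Summit.HubbardSuperconductivity.HubbardSuperconductivity.Theorems.EngineV8

end
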